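import Summits.AtomisticToContinuum.FouriersLaw.Theses.EmbeddedDrudeMourre
import Summits.AtomisticToContinuum.FouriersLaw.Theorems.FGRGap.Negative.LoadBearing
import Summits.AtomisticToContinuum.FouriersLaw.Theorems.FGRGap.Negative.OnsiteReduction

/-!
# Skeleton line `log-coercive-compact-resolvent` for crux `FGRGap` (stmt-AtomisticToContinuum-12595)

Route `EmbeddedDrudeMourre`, crux r3 `FGRGap` =
`∀ ω₂ a b : ℝ, 0 < ω₂ → 0 < a → 0 < b → PhononBoltzmann.HasOddSectorGap ω₂ a b`
(odd-sector spectral gap of ALS's linearised 2↔2 phonon-Boltzmann form `q = boltzmannForm ω₂ a b`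
of the pinned band `ω² = ω₂ + 2(1 - cos k)`, vertex `Φ = a + 16b∏ sin(k_j/2)`).

## The line (idea card `log-coercive-compact-resolvent`, crux-ideate r1 ideator 3; triage r1: 3 × pass)

DIRECT METHOD ON A COMPACT RESOLVENT.  The grazing collisions `(k, k₂; k+t, k₂-t)`, `k₂ → k*`
(equal-group-velocity partner) as `t → 0`, carry the collision weight `w ≍ 1/|t|` (the Jacobian
`|ω'(k₂) - ω'(k₂ - t)| ≤ ‖ω''‖∞ |t|`) — Lukkarinen's "formally infinite relaxation-time function"
[Lukkarinen2016 §3.4] — with a UNIFORMLY POSITIVE coefficient `(9/16π)Φ²(∏ω)⁻²/‖ω''‖∞ ≥ c·a²`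
(`Φ ≥ a/2` near grazing since `∏ sin(k_j/2) → sin²(k/2)sin²(k*/2) ≥ 0`).  Read in the inertial
range `|t| ≲ t₀` this gives

  (1) `q(f) ≥ c₁ · Q_H(f)`,  `Q_H(f) = ∫_cell dk ∫_{|t|<t₀} dt/|t| · (f(k) + f(H(k,t)) - f(k+t) - f(H(k,t)-t))²`
      (`stub_grazingLowerBound`; `H(k,t)` = the non-trivial resonant partner, `IsGrazingBranch`);
  (2) `Q_H(f) + C₂‖f‖² ≥ c₂ · G(f)`, `G(f) = ∫_cell dk ∫_{-1}^{1} dt/|t| (f(k+t) - f(k))²`  (the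
      log-Sobolev / Gagliardo functional, `≍ Σ log(2+|n|)|f̂ₙ|²`) — the DECORRELATION estimate: the
      bracket is `g_t(T_t k) - g_t(k)` with `g_t = f(·+t) - f`, `T_t(k) = H(k,t) - t` an orientation-
      REVERSING circle map moving with `t` (`∂_t T_t = β - 1 ≠ 0`, drift `β₂t²` at the fixed points
      `±k_m`, `β₂ = -v‴(k_m)/(6v″(k_m)) ≠ 0`), so the two increments cannot stay correlated over a
      range of `t` (`stub_grazingDecorrelation`, HARDEST — the card's C⁺ `LogCoercive` = (1)+(2));
  (3) `q` is lower semicontinuous along a.e.-convergent sequences of periodic functions (Fatou on the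
      lower Lebesgue integral; the pull-backs `(k₁,k₃) ↦ h(k₁,k₃)`, `↦ k₄` are non-singular)
      (`stub_formLowerSemicontinuous`);
  (4) (1)+(2) ⇒ the form domain sits in the log-Sobolev space, whose unit ball is COMPACT in `L²(𝕋)`;
      with (3) the direct method gives an odd unit MINIMISER `f₀` of `q` (`stub_oddInfAttained`);
  (5) an `L²` null vector of `q` agrees a.e. with a `C¹` collisional invariant (LS08 §5 averaging
      bootstrap; `∂₃h ≠ 0` off two transversal curves per row, `∂₃h ≠ 1` everywhere)
      (`stub_nullVectorRegularity` — stated verbatim as the sibling line fold-jet-rigidity's S2);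
  (6) every odd `C¹` `2π`-periodic collisional invariant of the pinned band vanishes (gen-1 cdisprove,
      `NoOddC1Invariant.lean`, 883 lines, rc 0 / 0 sorries, evidence 2026-08-15T22:49Z on this item —
      to be landed verbatim) (`stub_noOddC1Invariant`).
`FGRGap_of`: `q(f₀) ≠ 0` by (5)+(6) (else `‖f₀‖² = 0 ≠ 1`), and `g = q(f₀)` (or any `g` if
`q(f₀) = ∞`) is the gap constant — kernel-checked composition, no `sorry` outside the stubs.

## Disproof used (`Cruxes/FGRGap/Disproof.lean`, cdisprove gen 2 c1, NO KILL; landed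
`Theorems/FGRGap/Negative/{LoadBearing,OnsiteReduction}` — both IMPORTED here, nothing in them
refutes an instance of a stub)
* `hasOddSectorGap_false_without_periodic` (witness `k ↦ k`) — HONOURED: every stub quantifies over
  `Function.Periodic f (2π)`; the line USES periodicity at `stub_grazingLowerBound` (wrap-around of the
  strip `|k₃ - k₁| < t₀` on the torus) and at `stub_grazingDecorrelation` (`T_t` is a CIRCLE map; for
  `f = id` one has `G(id) > 0 = Q_H(id)`… no: `id` is not periodic, so (2) is not claimed for it).
* `hasOddSectorGap_false_without_odd` (witnesses `1, ω`) — HONOURED: (1)–(5) are parity-blind and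
  consistent with the even null vectors (`G(1) = 0`; `G(ω) < ∞` is absorbed by `C‖f‖²`); oddness enters
  ONLY at `stub_noOddC1Invariant` and in the odd variational problem of `stub_oddInfAttained`.
* `crux_false_without_omegaPos` — HONOURED: `0 < ω₂` (gapped analytic band, `‖ω''‖∞ < ∞`, Morse
  group velocity with exactly two critical points `±k_m`) is a hypothesis of stubs 1, 2, 3, 5, 6.
* `crux_false_without_couplings` and the sorried near-miss `not_hasOddSectorGap_zero_onsite` (`a = 0`
  gapless, `q/‖f‖² ≍ ε²` on odd bumps at `k = 0`) — HONOURED: "the line uses `0 < a` at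
  `stub_grazingLowerBound`" (`c₁ ∝ a²`; at `a = 0` the grazing coefficient dies at `k = 0, π = 0*`).
* `onsite_of_crux` / `crux_on_cone_of_onsite` / `crux_iff_unit_onsite` (`0 < b` NOT load-bearing) —
  CONSISTENT: every stub is stated for `0 ≤ b`.
* `no_uniform_gap` (no `ω₂`-uniform constant) — CONSISTENT: `t₀, c₁, c₂, C₂` depend on `(ω₂, a, b)`.
* `boltzmannForm_mono_weight` — the mechanism of (1) (drop all but the grazing root, bound its weight).
* `ledger negatives --problem AtomisticToContinuum`: 12 statements, none on `q` / `HasOddSectorGap` /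
  collisional invariants (triage r1-1/2/3) — no stub is an instance of one.
-/

noncomputable section

open MeasureTheory Set Real Filter Topology
open scoped ENNReal
open Literature.MathematicalPhysics.KineticTheory.PhononBoltzmann

namespace Summit.AtomisticToContinuum.FouriersLaw.Cruxes.FGRGap.LogCoerciveCompactResolvent

/-! ### Objects of the line -/

/-- The log-Sobolev (Gagliardo) functional on the Brillouin cell,
`G(f) = ∫_{(-π,π]} dk ∫_{(-1,1)} dt (f(k+t) - f(k))²/|t| ∈ [0, ∞]`; for `2π`-periodic `f`,
`G(f) = Σₙ K(n)|f̂ₙ|²/π`-type with `K(n) = ∫_{-1}^{1}|e^{int} - 1|² dt/|t| = 4 log n + O(1)`. -/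
def gagliardoLog (f : ℝ → ℝ) : ℝ≥0∞ :=
  ∫⁻ k in Ioc (-π) π, ∫⁻ t in Ioo (-1 : ℝ) 1, ENNReal.ofReal ((f (k + t) - f k) ^ 2 / |t|)

/-- The GRAZING FUNCTIONAL of a partner map `H` on the strip `|t| < t₀`:
`Q_H(f) = ∫_{(-π,π]} dk ∫_{(-t₀,t₀)} dt (f(k) + f(H(k,t)) - f(k+t) - f(H(k,t) - t))²/|t|` — the collision
bracket of `(k, H(k,t)) → (k+t, H(k,t) - t)` against the bare grazing rate `dt/|t|` (no vertex, no band
weights). -/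
def grazingFunctional (H : ℝ → ℝ → ℝ) (t₀ : ℝ) (f : ℝ → ℝ) : ℝ≥0∞ :=
  ∫⁻ k in Ioc (-π) π, ∫⁻ t in Ioo (-t₀) t₀,
    ENNReal.ofReal ((f k + f (H k t) - f (k + t) - f (H k t - t)) ^ 2 / |t|)

/-- `H` is (an a.e. selection of) THE GRAZING BRANCH of the band `ω₂` on the strip `|t| < t₀`: jointly
measurable, and for a.e. `(k, t) ∈ (-π,π] × (-t₀,t₀)` the point `H(k,t) ∈ (-π, π]` is a resonant partner of
the collision `(k, ·) → (k + t, ·)` (`Ω(k, H, k+t) = 0`), is NOT the trivial (exchange) root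
`k₂ ≡ k + t (mod 2π)`, and is the ONLY non-trivial root in the cell. (For small `t₀` this pins `H` a.e.:
`ω(x) - ω(x - t) = ω(k+t) - ω(k)` has exactly the two solutions `x ≡ k + t` and `x ≡ H(k,t) → k*` because
the `t`-averaged group velocity is, like `ω' = sin/ω`, a Morse function of the circle with two critical
points.) -/
def IsGrazingBranch (ω₂ t₀ : ℝ) (H : ℝ → ℝ → ℝ) : Prop :=
  Measurable (Function.uncurry H) ∧
    ∀ᵐ p : ℝ × ℝ ∂(volume.restrict (Ioc (-π) π ×ˢ Ioo (-t₀) t₀)),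
      H p.1 p.2 ∈ resonantSet ω₂ p.1 (p.1 + p.2) ∧
        (∀ n : ℤ, H p.1 p.2 - (p.1 + p.2) ≠ n * (2 * π)) ∧
          ∀ k₂ ∈ resonantSet ω₂ p.1 (p.1 + p.2),
            (∀ n : ℤ, k₂ - (p.1 + p.2) ≠ n * (2 * π)) → k₂ = H p.1 p.2

/-- LOG-COERCIVITY of `q_{ω₂,a,b}` (the card's C⁺ `LogCoercive` at fixed parameters):
`c·G(f) ≤ q(f) + C‖f‖²` for all periodic measurable `f ∈ L²`. -/
def LogCoerciveAt (ω₂ a b : ℝ) : Prop :=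
  ∃ c C : ℝ, 0 < c ∧ ∀ f : ℝ → ℝ, Function.Periodic f (2 * π) → Measurable f → cellNormSq f < ⊤ →
    ENNReal.ofReal c * gagliardoLog f ≤ boltzmannForm ω₂ a b f + ENNReal.ofReal C * cellNormSq f

/-- Sequential LOWER SEMICONTINUITY of `q_{ω₂,a,b}` along sequences of periodic measurable functions
converging a.e. on the cell. -/
def FormLowerSemicontinuousAt (ω₂ a b : ℝ) : Prop :=
  ∀ (F : ℕ → ℝ → ℝ) (f : ℝ → ℝ), (∀ n, Function.Periodic (F n) (2 * π)) → (∀ n, Measurable (F n)) →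
    Function.Periodic f (2 * π) → Measurable f →
      (∀ᵐ k ∂(volume.restrict (Ioc (-π) π)), Tendsto (fun n => F n k) atTop (𝓝 (f k))) →
        boltzmannForm ω₂ a b f ≤ liminf (fun n => boltzmannForm ω₂ a b (F n)) atTop

/-- The ODD INFIMUM of `q` IS ATTAINED: an odd periodic measurable `f₀` with `‖f₀‖² = 1` whose value
bounds the Rayleigh quotient of every odd admissible `f` from below, `q(f₀)·‖f‖² ≤ q(f)`. -/
def OddInfAttainedAt (ω₂ a b : ℝ) : Prop :=
  ∃ f₀ : ℝ → ℝ, Function.Periodic f₀ (2 * π) ∧ Measurable f₀ ∧ Function.Odd f₀ ∧ cellNormSq f₀ = 1 ∧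
    ∀ f : ℝ → ℝ, Function.Periodic f (2 * π) → Measurable f → Function.Odd f → cellNormSq f < ⊤ →
      boltzmannForm ω₂ a b f₀ * cellNormSq f ≤ boltzmannForm ω₂ a b f

/-! ### The six statements of the line (named; each IS its registered stub, see `…_holds` below) -/

/-- Statement of `stub_grazingLowerBound`. -/
def GrazingLowerBound : Prop :=
  ∀ ω₂ a b : ℝ, 0 < ω₂ → 0 < a → 0 ≤ b →
    ∃ (t₀ c : ℝ) (H : ℝ → ℝ → ℝ), 0 < t₀ ∧ 0 < c ∧ IsGrazingBranch ω₂ t₀ H ∧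
      ∀ f : ℝ → ℝ, Function.Periodic f (2 * π) → Measurable f →
        ENNReal.ofReal c * grazingFunctional H t₀ f ≤ boltzmannForm ω₂ a b f

/-- Statement of `stub_grazingDecorrelation`. -/
def GrazingDecorrelation : Prop :=
  ∀ (ω₂ t₀ : ℝ) (H : ℝ → ℝ → ℝ), 0 < ω₂ → 0 < t₀ → IsGrazingBranch ω₂ t₀ H →
    ∃ c C : ℝ, 0 < c ∧ ∀ f : ℝ → ℝ, Function.Periodic f (2 * π) → Measurable f → cellNormSq f < ⊤ →
      ENNReal.ofReal c * gagliardoLog f ≤ grazingFunctional H t₀ f + ENNReal.ofReal C * cellNormSq f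

/-- Statement of `stub_formLowerSemicontinuous`. -/
def FormLowerSemicontinuous : Prop :=
  ∀ ω₂ a b : ℝ, 0 < ω₂ → FormLowerSemicontinuousAt ω₂ a b

/-- Statement of `stub_oddInfAttained`. -/
def OddInfAttained : Prop :=
  ∀ ω₂ a b : ℝ, LogCoerciveAt ω₂ a b → FormLowerSemicontinuousAt ω₂ a b → OddInfAttainedAt ω₂ a b

/-- Statement of `stub_nullVectorRegularity` (verbatim the statement of stub S2 of the sibling line
`fold-jet-rigidity`, so that ONE proof serves both lines; `C³` costs nothing: the bootstrap gives `C^∞`). -/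
def NullVectorRegular : Prop :=
  ∀ ω₂ a b : ℝ, 0 < ω₂ → 0 < a → 0 ≤ b → ∀ f : ℝ → ℝ,
    Function.Periodic f (2 * π) → Measurable f → Function.Odd f → cellNormSq f < ∞ →
      boltzmannForm ω₂ a b f = 0 →
        ∃ ψ : ℝ → ℝ, ContDiff ℝ 3 ψ ∧ Function.Periodic ψ (2 * π) ∧ Function.Odd ψ ∧
          IsCollisionalInvariant ω₂ ψ ∧
            f =ᵐ[MeasureTheory.volume.restrict (Set.Ioc (-π) π)] ψ

/-- Statement of `stub_noOddC1Invariant`. -/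
def NoOddC1Invariant : Prop :=
  ∀ ω₂ : ℝ, 0 < ω₂ → ∀ ψ : ℝ → ℝ, ContDiff ℝ 1 ψ → Function.Periodic ψ (2 * π) → Function.Odd ψ →
    IsCollisionalInvariant ω₂ ψ → ∀ k : ℝ, ψ k = 0

/-! ### Registered stubs (the ONLY `sorry`s of this file) -/

/-- STUB 1 (M/L, provable now) — GRAZING LOWER BOUND.  For `ω₂ > 0`, `a > 0`, `b ≥ 0` there are
`t₀ ∈ (0, 1]`-small, `c > 0` and an a.e.-selection `H` of the grazing branch (`IsGrazingBranch`) with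
`c · Q_H(f) ≤ q(f)` for every periodic measurable `f`.  Proof: (i) for `0 < |t| < t₀` and every `k`
with `k + t` not critical for the `t`-averaged velocity `ṽ_t(x) = (ω(x) - ω(x-t))/t` — a `C²`-small
perturbation of the Morse function `ω' = sin/ω` of the circle (critical points `±k_m` only,
`cos k_m = c₋ = ((ω₂+2) - √((ω₂+2)²-4))/2`, both nondegenerate) — the resonance
`ṽ_t(x) = ṽ_t(k+t)` has exactly two roots mod `2π`: `x ≡ k+t` (exchange) and `x = H(k,t)` (define `H`
there, measurably; elsewhere anything); (ii) in `boltzmannForm` restrict `k₃` to the strip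
`|k₃ - k₁| < t₀ (mod 2π)` and the `finsum` to the root `H` (all terms are `≥ 0`; periodicity of `f`, of
`resonantSet` and of `collisionWeight` in `k₃` handles the wrap-around, cf. `boltzmannForm_mono_weight`);
(iii) on the strip `w(k₁, H, k₁+t) ≥ c/|t|` with `c = (9/16π)(a/2)²(ω₂+4)⁻⁴/‖ω''‖∞`: Jacobian
`|ω'(H) - ω'(H-t)| ≤ ‖ω''‖∞|t|` (it is `≠ 0` at a non-trivial root), `(∏ω)² ≤ (ω₂+4)⁴`, and
`Φ = a + 16b∏ sin(k_j/2) ≥ a/2` because `∏ sin → sin²(k₁/2)sin²(H/2) ≥ 0` as `t → 0`, `|t| ≤ t₀ ≲ a/b`;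
(iv) change variables `k₃ = k₁ + t` (Tonelli).  Uses `0 < a` (HONOURS `not_hasOddSectorGap_zero_onsite`:
at `a = 0` the coefficient vanishes at `k = 0, π`) and `0 < ω₂`.  Leans on: `hasDerivAt_dispersion`,
`hasDerivAt_resonanceFn`, `resonantSet_finite` (PinnedChainResonantFinite), `collisionWeight_add_two_pi`,
`boltzmannForm_mono_weight` (pattern), `MeasureTheory.lintegral_prod`, `setLIntegral_mono`. -/
theorem stub_grazingLowerBound :
    ∀ ω₂ a b : ℝ, 0 < ω₂ → 0 < a → 0 ≤ b →
      ∃ (t₀ c : ℝ) (H : ℝ → ℝ → ℝ), 0 < t₀ ∧ 0 < c ∧ IsGrazingBranch ω₂ t₀ H ∧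
        ∀ f : ℝ → ℝ, Function.Periodic f (2 * π) → Measurable f →
          ENNReal.ofReal c * grazingFunctional H t₀ f ≤ boltzmannForm ω₂ a b f := by
  sorry

/-- STUB 2 (XL, OPEN — HARDEST, the bet of the line; the card's C⁺ minus the kinematics of STUB 1) —
GRAZING DECORRELATION.  For the grazing branch `H` of a band `ω₂ > 0` on a strip `|t| < t₀`:
`c·G(f) ≤ Q_H(f) + C‖f‖²` for all periodic measurable `f ∈ L²` (constants depending on `ω₂, t₀`).
Mechanism: `f(k) + f(H) - f(k+t) - f(H-t) = g_t(T_t k) - g_t(k)`, `g_t := f(·+t) - f`,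
`T_t(k) := H(k,t) - t`, and `G(f) ≈ ∫ dt/|t| ‖g_t‖²` (the part `t₀ ≤ |t| < 1` of `G` is `≤ (8/t₀)‖f‖²`).
`T_t` is an orientation-REVERSING circle diffeomorphism (`T_0 = *`, the velocity involution, `σ = (k*)' < 0`)
that MOVES with `t`: `∂_t T_t|_{t=0} = β - 1 = (σ - 1)/2 ≠ 0`, and at the fixed points `±k_m` of `*`
(`σ = -1`) the partner DRIFTS, `T_t(k_m) + t - k_m = β₂t²`, `β₂ = -v‴(k_m)/(6v″(k_m)) ≠ 0` (fold normal
form `E_P(u) = E₀ - αηu² + βu⁴`; measured `0.2061` vs `0.2067` at `ω₂ = 1`).  So `‖g_t ∘ T_t - g_t‖²`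
can be `≪ ‖g_t‖²` only for isolated `t`: away from `±k_m` the phases `n·k` and `n·T_t(k)` have different
`t`-frequencies (van der Corput in `t` after localising in `k`; integrate by parts using `∂_t T_t ≠ 0`),
and at `±k_m` a packet of frequency `N` decorrelates once `β₂t²N ≳ 1`, leaving the inertial range
`(β₂N)^{-1/2} ≲ |t| ≲ t₀` worth `½ log N` of the `log N` in `G` — the constant halves, the growth
survives (triage r1-3).  Why it might fail: a drift-adapted chirp family with `Q_H/G → 0` (none found:
T4 kit j005103 odd `n^{-1/2}`-packets at `k_m` grow `0.068 → 0.427`, `n = 8 … 256`, slope `0.10` vs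
`0.13` for `sin(n·)`; Disproof §3(B) two-window Galerkin keeps `+0.03`/halving; triage r1-1 §G: the
grazing-adapted chirps have BOUNDED `G`-quotient, so they do not test this stub; T6 = kit j010993
(triage r1-3, FM packets `1/w ≪ N ≪ 1/w²`) pending).  A FALSE here kills only this line's route to
compactness (fallback: Lukkarinen's mollified `V - K` + Weyl, the jet cards' stub), not the crux.
No Mathlib support for van der Corput / stationary phase: by hand.  Leans on: `IsGrazingBranch`
(a.e. uniqueness pins `H` to the analytic branch: `HasStrictFDerivAt.implicitFunction`,
`hasDerivAt_resonanceFn`), `Function.Periodic`, `MeasureTheory.lintegral_prod`, Parseval on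
`AddCircle` (`tsum_sq_fourierCoeff`) if the Fourier form of `G` is used. -/
theorem stub_grazingDecorrelation :
    ∀ (ω₂ t₀ : ℝ) (H : ℝ → ℝ → ℝ), 0 < ω₂ → 0 < t₀ → IsGrazingBranch ω₂ t₀ H →
      ∃ c C : ℝ, 0 < c ∧ ∀ f : ℝ → ℝ, Function.Periodic f (2 * π) → Measurable f →
        cellNormSq f < ⊤ →
          ENNReal.ofReal c * gagliardoLog f ≤
            grazingFunctional H t₀ f + ENNReal.ofReal C * cellNormSq f := by
  sorry

/-- STUB 3 (L, provable now) — THE FORM IS LOWER SEMICONTINUOUS along a.e.-convergent sequences of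
periodic measurable functions (`ω₂ > 0`, any `a, b`).  Proof: a.e. convergence on the cell lifts to
a.e. on `ℝ` by periodicity; for a.e. `(k₁, k₃)` the resonant set is finite (`resonantSet_finite`: off the
diagonal) and consists of the exchange root (bracket `≡ 0` for periodic `f`) and the non-trivial root(s)
`k₂ = h(k₁,k₃)`, real-analytic in `(k₁,k₃)` off a null set (analytic implicit function theorem where
`∂₂Ω ≠ 0`; where `∂₂Ω = 0` the weight is the junk `0`); a non-constant real-analytic map pulls null sets
back to null sets (it is a submersion off its critical set, a proper analytic subset), so
`F n (h(k₁,k₃)) → f(h(k₁,k₃))` and `F n (k₄) → f(k₄)` for a.e. `(k₁,k₃)` as well; conclude by Fatou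
(`lintegral_liminf_le`, twice) and `Σ liminf ≤ liminf Σ` on the finite sum, the weight being `≥ 0` and
`n`-independent.  The measurability of `(k₁,k₃) ↦ Σ_{k₂} w·(bracket)²` (needed by Fatou) comes from the
same description of the resonant set.  This is the closability half of "`q` is a closed form"; every
compactness route to the gap needs it (the jet cards use it as "`q(f) ≤ liminf q(f_n)`", triage r1-2/3).
Why it might need care: the global structure of the non-trivial sheet (`∂₁h ≠ 0` always, ALS "one-to-one";
Disproof §3(C): `∂₃h` vanishes on 2 transversal curves per row, `∂₃h ≠ 1`) is used only through
"analytic and non-constant".  Leans on: `analyticAt_resonanceFn` / `resonantSet_finite` (Disproof §4,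
landed as `PinnedChainResonantFinite`), `AnalyticAt` IFT (`HasStrictFDerivAt.implicitFunction`),
`MeasureTheory.lintegral_liminf_le`, `Function.Periodic`. -/
theorem stub_formLowerSemicontinuous :
    ∀ ω₂ a b : ℝ, 0 < ω₂ → FormLowerSemicontinuousAt ω₂ a b := by
  sorry

/-- STUB 4 (M/L, provable now; pure functional analysis on `L²(𝕋)`) — THE ODD INFIMUM IS ATTAINED
under log-coercivity and lower semicontinuity (the "compact resolvent" step of the card).  Proof: let
`m = inf {q(f) : f odd, periodic, measurable, ‖f‖² = 1} ∈ [0, ∞]`.  If `m = ∞` take `f₀ = sin/√π`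
(`‖sin‖² = π`; then `q ≡ ∞` on odd `f` with `0 < ‖f‖² < ∞` by the scaling `boltzmannForm_const_mul`, and
`∞ · 0 = 0`).  If `m < ∞` take odd unit `f_n` with `q(f_n) → m`; log-coercivity bounds `G(f_n)`; the set
`{‖f‖² ≤ 1, G(f) ≤ M}` of periodic functions is relatively COMPACT in `L²(cell)` (Fourier:
`G(f) ≥ Σ K(n)|f̂ₙ|²`-type with `K(n) → ∞`, so uniform tail decay; or Riesz–Kolmogorov); a subsequence
converges in `L²(cell)` and a further one a.e. to (a periodic, odd, measurable representative) `f₀` with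
`‖f₀‖² = 1`; lower semicontinuity gives `q(f₀) ≤ m`, and `m·‖f‖² ≤ q(f)` for odd `f` is the definition
of `m` after normalising `f` (`cellNormSq_const_mul`, `boltzmannForm_const_mul`).  No hypothesis on the
parameters is needed (only the two named properties and the `t²`-homogeneity of `q` and `‖·‖²`).
Leans on: `boltzmannForm_const_mul`, `cellNormSq_const_mul`, `MeasureTheory.Lp`, Fourier series on
`AddCircle` (`fourierBasis`, `tsum_sq_fourierCoeff`), `TendstoInMeasure.exists_seq_tendsto_ae` /
`MeasureTheory.Memℒp` subsequence extraction, `IsCompact.isSeqCompact`, `toIocMod` (periodic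
representative). -/
theorem stub_oddInfAttained :
    ∀ ω₂ a b : ℝ, LogCoerciveAt ω₂ a b → FormLowerSemicontinuousAt ω₂ a b →
      OddInfAttainedAt ω₂ a b := by
  sorry

/-- STUB 5 (L, provable now; stated VERBATIM as stub S2 `stub_nullVectorRegularity` of the sibling line
`fold-jet-rigidity`, so one proof serves both) — `L²` NULL VECTORS ARE SMOOTH INVARIANTS (the bootstrap; half (a)
of the crux needs it in every line).  If `q(f) = 0` for an odd periodic measurable `f ∈ L²` then, `w` being `> 0`
a.e. on the non-trivial sheet (`Φ = a + 16b∏sin` vanishes at most on a curve; Jacobian `≠ 0` off the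
fold curves), `f(k₁) + f(h) = f(k₃) + f(k₄)` for a.e. `(k₁,k₃)`; AVERAGE in `k₃` against a smooth bump
supported where `k₃ ↦ h(k₁,k₃)` and `k₃ ↦ k₄ = k₁ + h - k₃` are submersions (`∂₃h ≠ 0`, `∂₃h ≠ 1`;
such windows exist for every `k₁`: Disproof §3(C), `bootstrap_deg.py`, ranges of `∂₃h` bounded away from
`1`) to see that `f` agrees a.e. with a CONTINUOUS function, then iterate once more for `C¹` (the averaged
right-hand side is as smooth as the bump after the change of variables `u = h(k₁,k₃)`; `C³` — indeed `C^∞` —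
in one step); a continuous
function satisfying the invariant identity on a dense subset of the resonant variety satisfies it
everywhere (closure; the exchange sheet and the diagonal are automatic for periodic `ψ`), and its odd
part (`IsCollisionalInvariant.oddPart`) still agrees with the odd `f` a.e.  This is the LS08 §5 device
in one dimension.  Why it might need care: measurability/selection of `h` globally (shared with STUB 3).
Leans on: `IsCollisionalInvariant`, `IsCollisionalInvariant.oddPart`, `resonantSet_finite`,
`integral_image_eq_integral_abs_deriv_smul` (change of variables), `ContDiff.continuous`,
`HasStrictFDerivAt.implicitFunction`, `intervalIntegral.integral_hasDerivAt_right`-type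
differentiation under the integral. -/
theorem stub_nullVectorRegularity :
    ∀ ω₂ a b : ℝ, 0 < ω₂ → 0 < a → 0 ≤ b → ∀ f : ℝ → ℝ,
      Function.Periodic f (2 * π) → Measurable f → Function.Odd f → cellNormSq f < ∞ →
        boltzmannForm ω₂ a b f = 0 →
          ∃ ψ : ℝ → ℝ, ContDiff ℝ 3 ψ ∧ Function.Periodic ψ (2 * π) ∧ Function.Odd ψ ∧
            IsCollisionalInvariant ω₂ ψ ∧
              f =ᵐ[MeasureTheory.volume.restrict (Set.Ioc (-π) π)] ψ := by
  sorry

/-- STUB 6 (L, DONE IN EVIDENCE — to be landed) — NO ODD `C¹` COLLISIONAL INVARIANT on the pinned band,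
for every `ω₂ > 0`: gen-1 cdisprove's `NoOddC1Invariant.lean` (item evidence 2026-08-15T22:49:36Z;
`eq_zero_of_odd_isCollisionalInvariant`: `HasDerivAt ψ ψ'` everywhere, `ψ'` continuous, `ψ` odd,
`2π`-periodic, `IsCollisionalInvariant ω₂ ψ ⇒ ψ = 0`; 883 lines, rc 0, 0 sorries, standard axioms; a
refuter cannot land non-`¬` theorems, so a prover lands it verbatim and derives this `ContDiff ℝ 1` form
via `contDiff_one_iff_deriv`-type glue).  Mechanism: parity resonance `(k, π-k) → (-k, π+k)` ⇒ `ψ'`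
even about `π/2`; order-`t` grazing law `ψ'(k*) = ψ'(k)` (fold family); the composite `ρ = (π - ·) ∘ *`
is a self-map of `[0, π]` with no interior fixed point (`ω(π-k) = ω(k)` only at `π/2 ≠ k_m`) ⇒ `ψ'`
constant ⇒ `ψ = 0` by oddness + periodicity.  Independent confirmations: cards grazing-jet-rigidity /
fold-jet-rigidity (t³-jet, classify ALL `C³` invariants as `span{1, ω}`), chord-quartic-abel (Abel + Bol).
Leans on: `IsCollisionalInvariant`, `groupVelocity`, `hasDerivAt_dispersion`, gen-1's
`FGRGapRigidity.eq_of_invariant_under_contraction`, `FGRGapOddInvariant` (unimodality of `sin/ω`). -/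
theorem stub_noOddC1Invariant :
    ∀ ω₂ : ℝ, 0 < ω₂ → ∀ ψ : ℝ → ℝ, ContDiff ℝ 1 ψ → Function.Periodic ψ (2 * π) →
      Function.Odd ψ → IsCollisionalInvariant ω₂ ψ → ∀ k : ℝ, ψ k = 0 := by
  sorry

/-! ### Consistency: each named statement IS its registered stub (definitionally) -/

theorem grazingLowerBound_holds : GrazingLowerBound := stub_grazingLowerBound
theorem grazingDecorrelation_holds : GrazingDecorrelation := stub_grazingDecorrelation
theorem formLowerSemicontinuous_holds : FormLowerSemicontinuous := stub_formLowerSemicontinuous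
theorem oddInfAttained_holds : OddInfAttained := stub_oddInfAttained
theorem nullVectorRegular_holds : NullVectorRegular := stub_nullVectorRegularity
theorem noOddC1Invariant_holds : NoOddC1Invariant := stub_noOddC1Invariant

/-! ### Name-keyed aliases of the six statements (the hypotheses of the composition) -/
namespace Registered

/-- Alias of `GrazingLowerBound` keyed by the registered stub name. -/
abbrev stub_grazingLowerBound : Prop := GrazingLowerBound
/-- Alias of `GrazingDecorrelation` keyed by the registered stub name. -/
abbrev stub_grazingDecorrelation : Prop := GrazingDecorrelation
/-- Alias of `FormLowerSemicontinuous` keyed by the registered stub name. -/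
abbrev stub_formLowerSemicontinuous : Prop := FormLowerSemicontinuous
/-- Alias of `OddInfAttained` keyed by the registered stub name. -/
abbrev stub_oddInfAttained : Prop := OddInfAttained
/-- Alias of `NullVectorRegular` keyed by the registered stub name. -/
abbrev stub_nullVectorRegularity : Prop := NullVectorRegular
/-- Alias of `NoOddC1Invariant` keyed by the registered stub name. -/
abbrev stub_noOddC1Invariant : Prop := NoOddC1Invariant

end Registered

/-! ### Glue (proved) -/

/-- STUBS 1 + 2 ⇒ log-coercivity of `q_{ω₂,a,b}` (`ω₂ > 0`, `a > 0`, `b ≥ 0`): chain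
`c₁c₂·G ≤ c₁·Q_H + c₁C₂‖f‖² ≤ q + c₁C₂‖f‖²`. -/
theorem logCoerciveAt_of_grazing (h1 : GrazingLowerBound) (h2 : GrazingDecorrelation) {ω₂ a b : ℝ}
    (hω : 0 < ω₂) (ha : 0 < a) (hb : 0 ≤ b) : LogCoerciveAt ω₂ a b := by
  obtain ⟨t₀, c₁, H, ht₀, hc₁, hH, hq⟩ := h1 ω₂ a b hω ha hb
  obtain ⟨c₂, C₂, hc₂, hG⟩ := h2 ω₂ t₀ H hω ht₀ hH
  refine ⟨c₁ * c₂, c₁ * C₂, mul_pos hc₁ hc₂, fun f hper hmeas hfin => ?_⟩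
  have e1 := hq f hper hmeas
  have e2 := hG f hper hmeas hfin
  calc ENNReal.ofReal (c₁ * c₂) * gagliardoLog f
      = ENNReal.ofReal c₁ * (ENNReal.ofReal c₂ * gagliardoLog f) := by
        rw [ENNReal.ofReal_mul hc₁.le, mul_assoc]
    _ ≤ ENNReal.ofReal c₁ * (grazingFunctional H t₀ f + ENNReal.ofReal C₂ * cellNormSq f) :=
        mul_le_mul' le_rfl e2
    _ = ENNReal.ofReal c₁ * grazingFunctional H t₀ f + ENNReal.ofReal (c₁ * C₂) * cellNormSq f := by
        rw [mul_add, ENNReal.ofReal_mul hc₁.le, mul_assoc]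
    _ ≤ boltzmannForm ω₂ a b f + ENNReal.ofReal (c₁ * C₂) * cellNormSq f := add_le_add e1 le_rfl

/-- STUBS 5 + 6 ⇒ no odd `L²` null vector (half (a) of the crux): an odd periodic measurable `f ∈ L²`
with `q(f) = 0` has `‖f‖² = 0`. -/
theorem cellNormSq_eq_zero_of_null (h5 : NullVectorRegular) (h6 : NoOddC1Invariant) {ω₂ a b : ℝ}
    (hω : 0 < ω₂) (ha : 0 < a) (hb : 0 ≤ b) {f : ℝ → ℝ} (hper : Function.Periodic f (2 * π))
    (hmeas : Measurable f) (hodd : Function.Odd f) (hfin : cellNormSq f < ⊤)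
    (hq : boltzmannForm ω₂ a b f = 0) : cellNormSq f = 0 := by
  obtain ⟨ψ, hψC3, hψper, hψodd, hψinv, hae⟩ := h5 ω₂ a b hω ha hb f hper hmeas hodd hfin hq
  have hψC1 : ContDiff ℝ 1 ψ := hψC3.of_le (by norm_num)
  have hψ0 : ∀ k, ψ k = 0 := h6 ω₂ hω ψ hψC1 hψper hψodd hψinv
  have hae' : (fun k => ENNReal.ofReal (f k ^ 2)) =ᵐ[volume.restrict (Ioc (-π) π)] fun _ => 0 := by
    filter_upwards [hae] with k hk
    rw [hk, hψ0 k]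
    simp
  unfold cellNormSq
  rw [lintegral_congr_ae hae', lintegral_zero]

/-- An attained, non-zero odd infimum is a gap constant (including the corner `q(f₀) = ∞`, where every
odd `f` with `0 < ‖f‖² < ∞` has `q(f) = ∞` and any positive real works). -/
theorem hasOddSectorGap_of_minimiser {ω₂ a b : ℝ} {f₀ : ℝ → ℝ}
    (hmin : ∀ f : ℝ → ℝ, Function.Periodic f (2 * π) → Measurable f → Function.Odd f →
      cellNormSq f < ⊤ → boltzmannForm ω₂ a b f₀ * cellNormSq f ≤ boltzmannForm ω₂ a b f)
    (hq0 : boltzmannForm ω₂ a b f₀ ≠ 0) : HasOddSectorGap ω₂ a b := by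
  by_cases htop : boltzmannForm ω₂ a b f₀ = ⊤
  · refine ⟨1, one_pos, fun f hper hmeas hodd hfin => ?_⟩
    have h := hmin f hper hmeas hodd hfin
    rw [htop] at h
    by_cases hN : cellNormSq f = 0
    · rw [hN, mul_zero]
      exact bot_le
    · rw [ENNReal.top_mul hN] at h
      exact le_trans le_top h
  · refine ⟨(boltzmannForm ω₂ a b f₀).toReal, ENNReal.toReal_pos hq0 htop,
      fun f hper hmeas hodd hfin => ?_⟩
    rw [ENNReal.ofReal_toReal htop]
    exact hmin f hper hmeas hodd hfin

/-! ### The composition: the six stubs imply the crux, by name -/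

/-- `FGRGap` from the six stubs (real proof, no `sorry`): for `ω₂, a, b > 0`, STUBS 1+2 give
log-coercivity, STUB 3 lower semicontinuity, STUB 4 an odd unit minimiser `f₀`; STUBS 5+6 forbid
`q(f₀) = 0` (it would force `‖f₀‖² = 0 ≠ 1`); the minimiser's value is the gap. -/
theorem FGRGap_of (h1 : Registered.stub_grazingLowerBound) (h2 : Registered.stub_grazingDecorrelation)
    (h3 : Registered.stub_formLowerSemicontinuous) (h4 : Registered.stub_oddInfAttained)
    (h5 : Registered.stub_nullVectorRegularity) (h6 : Registered.stub_noOddC1Invariant) :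
    Summit.AtomisticToContinuum.FouriersLaw.Theses.EmbeddedDrudeMourre.FGRGap := by
  intro ω₂ a b hω ha hb
  have hlc : LogCoerciveAt ω₂ a b := logCoerciveAt_of_grazing h1 h2 hω ha hb.le
  obtain ⟨f₀, hper, hmeas, hodd, hnorm, hmin⟩ := h4 ω₂ a b hlc (h3 ω₂ a b hω)
  have hq0 : boltzmannForm ω₂ a b f₀ ≠ 0 := by
    intro hq
    have hfin : cellNormSq f₀ < ⊤ := by rw [hnorm]; exact ENNReal.one_lt_top
    have h0 := cellNormSq_eq_zero_of_null h5 h6 hω ha hb.le hper hmeas hodd hfin hq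
    rw [hnorm] at h0
    exact one_ne_zero h0
  exact hasOddSectorGap_of_minimiser hmin hq0

/-- Wiring check: the registered stubs feed `FGRGap_of` as stated. -/
example : Summit.AtomisticToContinuum.FouriersLaw.Theses.EmbeddedDrudeMourre.FGRGap :=
  FGRGap_of stub_grazingLowerBound stub_grazingDecorrelation stub_formLowerSemicontinuous
    stub_oddInfAttained stub_nullVectorRegularity stub_noOddC1Invariant

end Summit.AtomisticToContinuum.FouriersLaw.Cruxes.FGRGap.LogCoerciveCompactResolvent

end
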